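import Summits.KontsevichZagierPeriods.KontsevichZagierPeriods.Theorems.SoloBlindCycChart
import HarnessLib

/-!
# The cyclic tangent chart is a bijection onto the box; the move of rule (2)

Dimension `k = n + 2`.  For `x ∈ (0,1)ᵏ` the cyclic linear system `σᵢ + xᵢ² σᵢ₊₁ = xᵢ²` has the
unique solution `σᵢ = xᵢ² Mᵢ₊₁ / D`, where `D = 1 − (−1)ᵏ ∏ⱼ xⱼ²` (`cycDen`) and
`Mᵢ = 1 − xᵢ²(1 − xᵢ₊₁²(1 − ⋯ (1 − xᵢ₊ₖ₋₂²)⋯))` (`cycM`, `k − 1` nested factors) satisfies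
`Mᵢ + xᵢ² Mᵢ₊₁ = D` (`cycM_add`, a telescoping identity for the nested sums `nestM`).  Hence
`σᵢ ∈ (0,1)` and `Ψ(x)ᵢ = √σᵢ/(1 + √(1 − σᵢ))` (`cycInv`) inverts the cyclic tangent chart
`Φ(t)ᵢ = S(tᵢ)/C(tᵢ₊₁)` of `SoloBlindCycChart`: **`Φ : T_k → (0,1)ᵏ` is a bijection**
(`cycChart_cycInv`, `cycInv_cycChart`, `image_cycChart`).  With the Jacobian of
`SoloBlindCycChart` this packages ONE move of Kontsevich–Zagier's rule (2)
(`equivalent_of_cycChart`): `[T_k, g(Φ t)·(1 − (−1)ᵏ(∏Φᵢ)²)·∏W(tᵢ)] ≡ [(0,1)ᵏ, g]`.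
-/

noncomputable section

namespace Summit.KontsevichZagierPeriods.KontsevichZagierPeriods.Theorems

open Set MeasureTheory
open Literature.ModelTheory.ExponentialFields (IsSemialgebraic)
open Literature.NumberTheory.Transcendental
open Literature.NumberTheory.Transcendental.KZ

namespace SoloBlind

variable {n : ℕ}

/-! ## Cyclic shifts `i + m•1` -/

/-- The value of `m • 1` in `Fin (n+2)`. -/
theorem val_nsmul_one (m : ℕ) : ((m • (1 : Fin (n + 2)) : Fin (n + 2)) : ℕ) = m % (n + 2) := by
  induction m with
  | zero => simp
  | succ m ih => rw [succ_nsmul, Fin.val_add, ih, Fin.val_one, Nat.mod_add_mod]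

/-- `l • 1 = l` in `Fin (n+2)`. -/
theorem val_smul_one_eq_self (l : Fin (n + 2)) : (l : ℕ) • (1 : Fin (n + 2)) = l :=
  Fin.ext (by rw [val_nsmul_one, Nat.mod_eq_of_lt l.isLt])

/-- `(n+2) • 1 = 0` in `Fin (n+2)`. -/
theorem nsmul_one_self : (n + 2) • (1 : Fin (n + 2)) = 0 :=
  Fin.ext (by rw [val_nsmul_one, Nat.mod_self, Fin.val_zero])

/-! ## Cyclic products and nested alternating sums -/

/-- Cyclic products `Πₘ(i) = xᵢ² xᵢ₊₁² ⋯ xᵢ₊ₘ₋₁²`. -/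
def cycProd (x : Fin (n + 2) → ℝ) : ℕ → Fin (n + 2) → ℝ
  | 0 => fun _ => 1
  | m + 1 => fun i => x i ^ 2 * cycProd x m (i + 1)

/-- `Πₘ(i)` as a product over `range m`. -/
theorem cycProd_eq_prod_range (x : Fin (n + 2) → ℝ) (m : ℕ) (i : Fin (n + 2)) :
    cycProd x m i = ∏ l ∈ Finset.range m, x (i + l • 1) ^ 2 := by
  induction m generalizing i with
  | zero => simp [cycProd]
  | succ m ih =>
    rw [show cycProd x (m + 1) i = x i ^ 2 * cycProd x m (i + 1) from rfl, ih,
      Finset.prod_range_succ', zero_nsmul, add_zero, mul_comm]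
    refine congrArg (· * x i ^ 2) (Finset.prod_congr rfl fun l _ => ?_)
    rw [succ_nsmul, ← add_assoc, add_right_comm]

/-- **The full cyclic product is `∏ⱼ xⱼ²`**, whatever the starting index. -/
theorem cycProd_full (x : Fin (n + 2) → ℝ) (i : Fin (n + 2)) :
    cycProd x (n + 2) i = ∏ j, x j ^ 2 := by
  rw [cycProd_eq_prod_range, ← Fin.prod_univ_eq_prod_range (fun l => x (i + l • 1) ^ 2) (n + 2)]
  simp_rw [val_smul_one_eq_self]
  exact Fintype.prod_equiv (Equiv.addLeft i) _ _ fun l => rfl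

/-- Nested alternating sums `Mₘ(i) = 1 − xᵢ²(1 − xᵢ₊₁²(⋯(1 − xᵢ₊ₘ₋₁²)⋯))`, `M₀ = 1`. -/
def nestM (x : Fin (n + 2) → ℝ) : ℕ → Fin (n + 2) → ℝ
  | 0 => fun _ => 1
  | m + 1 => fun i => 1 - x i ^ 2 * nestM x m (i + 1)

/-- On the box `0 < Mₘ(i) ≤ 1`. -/
theorem nestM_mem {x : Fin (n + 2) → ℝ} (hx : x ∈ kzOpenBox (n + 2)) :
    ∀ m i, 0 < nestM x m i ∧ nestM x m i ≤ 1
  | 0, i => by simp [nestM]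
  | m + 1, i => by
    obtain ⟨h0, h1⟩ := nestM_mem hx m (i + 1)
    have hy : x i ^ 2 < 1 := pow_lt_one₀ (hx i).1.le (hx i).2 two_ne_zero
    have hy0 : 0 < x i ^ 2 := pow_pos (hx i).1 2
    show 0 < 1 - x i ^ 2 * nestM x m (i + 1) ∧ 1 - x i ^ 2 * nestM x m (i + 1) ≤ 1
    constructor
    · nlinarith [mul_le_of_le_one_right hy0.le h1]
    · nlinarith [mul_pos hy0 h0]

/-- **Telescoping**: `Mₘ₊₁(i) − Mₘ(i) = (−1)ᵐ⁺¹ Πₘ₊₁(i)`. -/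
theorem nestM_succ_sub (x : Fin (n + 2) → ℝ) :
    ∀ m i, nestM x (m + 1) i - nestM x m i = (-1) ^ (m + 1) * cycProd x (m + 1) i
  | 0, i => by simp [nestM, cycProd]
  | m + 1, i => by
    have ih := nestM_succ_sub x m (i + 1)
    show (1 - x i ^ 2 * nestM x (m + 1) (i + 1)) - (1 - x i ^ 2 * nestM x m (i + 1)) =
      (-1) ^ (m + 2) * (x i ^ 2 * cycProd x (m + 1) (i + 1))
    linear_combination (-x i ^ 2) * ih

/-! ## The determinant `D`, the nested factor `M` and the solution `σ` -/

/-- `D(x) = 1 − (−1)ⁿ ∏ⱼ xⱼ²` (`(−1)ⁿ = (−1)ᵏ`, `k = n + 2`). -/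
def cycDen (n : ℕ) (x : Fin (n + 2) → ℝ) : ℝ := 1 - (-1) ^ n * ∏ j, x j ^ 2

/-- On the box `D(x) > 0`. -/
theorem cycDen_pos {x : Fin (n + 2) → ℝ} (hx : x ∈ kzOpenBox (n + 2)) : 0 < cycDen n x := by
  have hP := BoxIntegral.prod_mem_Ioo (by omega) hx
  have h1 : ∏ j, x j ^ 2 < 1 := by rw [Finset.prod_pow]; nlinarith [hP.1, hP.2]
  have h0 : 0 ≤ ∏ j, x j ^ 2 := Finset.prod_nonneg fun j _ => sq_nonneg (x j)
  unfold cycDen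
  rcases neg_one_pow_eq_or ℝ n with h | h <;> rw [h] <;> nlinarith

/-- `Mᵢ = M_{k−1}(i)`, the nested factor with `k − 1 = n + 1` levels. -/
def cycM (x : Fin (n + 2) → ℝ) (i : Fin (n + 2)) : ℝ := nestM x (n + 1) i

/-- On the box `Mᵢ > 0`. -/
theorem cycM_pos {x : Fin (n + 2) → ℝ} (hx : x ∈ kzOpenBox (n + 2)) (i : Fin (n + 2)) :
    0 < cycM x i :=
  (nestM_mem hx (n + 1) i).1

/-- **The key identity `Mᵢ + xᵢ² Mᵢ₊₁ = D`.** -/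
theorem cycM_add (x : Fin (n + 2) → ℝ) (i : Fin (n + 2)) :
    cycM x i + x i ^ 2 * cycM x (i + 1) = cycDen n x := by
  have h1 : x i ^ 2 * cycM x (i + 1) = 1 - nestM x (n + 2) i := by
    show x i ^ 2 * nestM x (n + 1) (i + 1) = 1 - (1 - x i ^ 2 * nestM x (n + 1) (i + 1))
    ring
  have h2 : nestM x (n + 2) i - nestM x (n + 1) i = (-1) ^ (n + 2) * cycProd x (n + 2) i :=
    nestM_succ_sub x (n + 1) i
  rw [cycProd_full] at h2
  rw [h1]
  unfold cycM cycDen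
  linear_combination -h2

/-- **The solution `σᵢ = xᵢ² Mᵢ₊₁ / D` of the cyclic system.** -/
def cycSigma (x : Fin (n + 2) → ℝ) (i : Fin (n + 2)) : ℝ := x i ^ 2 * cycM x (i + 1) / cycDen n x

/-- `1 − σᵢ = Mᵢ / D`. -/
theorem one_sub_cycSigma {x : Fin (n + 2) → ℝ} (hD : cycDen n x ≠ 0) (i : Fin (n + 2)) :
    1 - cycSigma x i = cycM x i / cycDen n x := by
  unfold cycSigma
  rw [eq_div_iff hD, sub_mul, div_mul_cancel₀ _ hD, one_mul, ← cycM_add x i, add_sub_cancel_right]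

/-- **The cyclic system**: `σᵢ + xᵢ² σᵢ₊₁ = xᵢ²`. -/
theorem cycSigma_rec {x : Fin (n + 2) → ℝ} (hD : cycDen n x ≠ 0) (i : Fin (n + 2)) :
    cycSigma x i + x i ^ 2 * cycSigma x (i + 1) = x i ^ 2 := by
  have h := one_sub_cycSigma hD (i + 1)
  have e : cycSigma x i = x i ^ 2 * (cycM x (i + 1) / cycDen n x) := by
    unfold cycSigma; ring
  rw [e, ← h]
  ring

/-- On the open box `σᵢ ∈ (0,1)`. -/
theorem cycSigma_mem {x : Fin (n + 2) → ℝ} (hx : x ∈ kzOpenBox (n + 2)) (i : Fin (n + 2)) :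
    cycSigma x i ∈ Ioo (0 : ℝ) 1 := by
  have hD := cycDen_pos hx
  refine ⟨div_pos (mul_pos (pow_pos (hx i).1 2) (cycM_pos hx (i + 1))) hD, ?_⟩
  have h := one_sub_cycSigma hD.ne' i
  have : 0 < cycM x i / cycDen n x := div_pos (cycM_pos hx i) hD
  linarith

/-- **Uniqueness for the cyclic system**: `dᵢ = −xᵢ² dᵢ₊₁` for all `i` forces `d = 0` if `D ≠ 0`. -/
theorem cyc_unique {x : Fin (n + 2) → ℝ} (hD : cycDen n x ≠ 0) {d : Fin (n + 2) → ℝ}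
    (hd : ∀ i, d i = -(x i ^ 2) * d (i + 1)) (i : Fin (n + 2)) : d i = 0 := by
  have key : ∀ m j, d j = (-1) ^ m * cycProd x m j * d (j + m • 1) := by
    intro m
    induction m with
    | zero => intro j; simp [cycProd]
    | succ m ih =>
      intro j
      rw [hd j, ih (j + 1), show cycProd x (m + 1) j = x j ^ 2 * cycProd x m (j + 1) from rfl,
        succ_nsmul, ← add_assoc j, add_right_comm j 1]
      ring
  have h := key (n + 2) i
  rw [cycProd_full, nsmul_one_self, add_zero] at h
  have h2 : cycDen n x * d i = 0 := by
    unfold cycDen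
    linear_combination h
  exact (mul_eq_zero.mp h2).resolve_left hD

/-! ## The inverse chart -/

/-- **The inverse chart** `Ψ(x)ᵢ = √σᵢ / (1 + √(1 - σᵢ))`. -/
def cycInv (x : Fin (n + 2) → ℝ) : Fin (n + 2) → ℝ := fun i =>
  √(cycSigma x i) / (1 + √(1 - cycSigma x i))

section inverse

variable {x : Fin (n + 2) → ℝ} (hx : x ∈ kzOpenBox (n + 2))
include hx

/-- `s = √σᵢ` and `c = √(1-σᵢ)`: `0 < s < 1`, `0 < c`, `s² + c² = 1`, `c² = 1 - σᵢ`. -/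
theorem cycInv_aux (i : Fin (n + 2)) :
    0 < √(cycSigma x i) ∧ √(cycSigma x i) < 1 ∧ 0 < √(1 - cycSigma x i) ∧
      √(cycSigma x i) ^ 2 + √(1 - cycSigma x i) ^ 2 = 1 ∧
        √(1 - cycSigma x i) ^ 2 = 1 - cycSigma x i := by
  have hσ := cycSigma_mem hx i
  have h1 : √(cycSigma x i) < 1 := by
    rw [show (1 : ℝ) = √1 from Real.sqrt_one.symm]
    exact Real.sqrt_lt_sqrt hσ.1.le hσ.2
  refine ⟨Real.sqrt_pos.mpr hσ.1, h1, Real.sqrt_pos.mpr (by linarith [hσ.2]), ?_, ?_⟩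
  · rw [Real.sq_sqrt hσ.1.le, Real.sq_sqrt (by linarith [hσ.2])]
    ring
  · exact Real.sq_sqrt (by linarith [hσ.2])

/-- `S(Ψ(x)ᵢ) = √σᵢ` and `C(Ψ(x)ᵢ) = √(1-σᵢ)`. -/
theorem tS_tC_cycInv (i : Fin (n + 2)) :
    tS (cycInv x i) = √(cycSigma x i) ∧ tC (cycInv x i) = √(1 - cycSigma x i) := by
  obtain ⟨_, _, hc, hsc, _⟩ := cycInv_aux hx i
  exact tS_tC_half_angle (by linarith) hsc

/-- `√σᵢ = xᵢ · √(1 - σᵢ₊₁)` (the cyclic system, square-rooted). -/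
theorem sqrt_cycSigma_eq (i : Fin (n + 2)) :
    √(cycSigma x i) = x i * √(1 - cycSigma x (i + 1)) := by
  obtain ⟨hs, _, _, _, _⟩ := cycInv_aux hx i
  obtain ⟨_, _, hc', _, hc'2⟩ := cycInv_aux hx (i + 1)
  have hrec := cycSigma_rec (cycDen_pos hx).ne' i
  refine (sq_eq_sq₀ hs.le (mul_nonneg (hx i).1.le hc'.le)).mp ?_
  rw [Real.sq_sqrt (cycSigma_mem hx i).1.le, mul_pow, hc'2]
  linarith

/-- **`Φ ∘ Ψ = id` on the open box.** -/
theorem cycChart_cycInv : cycChart n (cycInv x) = x := by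
  funext i
  obtain ⟨_, _, hc', _, _⟩ := cycInv_aux hx (i + 1)
  rw [cycChart_apply, (tS_tC_cycInv hx i).1, (tS_tC_cycInv hx (i + 1)).2, sqrt_cycSigma_eq hx i,
    mul_div_cancel_right₀ _ hc'.ne']

/-- **`Ψ` maps the open box into the cyclic tangent cell.** -/
theorem cycInv_mem : cycInv x ∈ cycCell n := by
  intro i
  obtain ⟨hs, hs1, hc, _, _⟩ := cycInv_aux hx i
  obtain ⟨_, _, hc', _, _⟩ := cycInv_aux hx (i + 1)
  have ht0 : 0 < cycInv x i := div_pos hs (by linarith)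
  have ht1 : cycInv x i < 1 := (div_lt_one (by linarith)).mpr (by linarith)
  have ht0' : 0 < cycInv x (i + 1) := div_pos (cycInv_aux hx (i + 1)).1 (by linarith)
  refine ⟨ht0, (tS_lt_tC_iff ht0.le ht1 ht0'.le).mp ?_⟩
  rw [(tS_tC_cycInv hx i).1, (tS_tC_cycInv hx (i + 1)).2, sqrt_cycSigma_eq hx i]
  exact mul_lt_of_lt_one_left hc' (hx i).2

end inverse

/-- On the cell, `σ(Φ(t))ᵢ = S(tᵢ)²` (uniqueness of the solution of the cyclic system). -/
theorem cycSigma_cycChart {t : Fin (n + 2) → ℝ} (ht : t ∈ cycCell n) (i : Fin (n + 2)) :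
    cycSigma (cycChart n t) i = tS (t i) ^ 2 := by
  have hD : cycDen n (cycChart n t) ≠ 0 := (cycDen_pos (cycChart_mem ht)).ne'
  have h := cyc_unique hD (d := fun j => tS (t j) ^ 2 - cycSigma (cycChart n t) j) (fun j => by
    have e1 := cycChart_sq_mul ht j
    have e2 := cycSigma_rec hD j
    show tS (t j) ^ 2 - cycSigma (cycChart n t) j =
      -(cycChart n t j ^ 2) * (tS (t (j + 1)) ^ 2 - cycSigma (cycChart n t) (j + 1))
    linear_combination -e1 - e2) i
  have h' : tS (t i) ^ 2 - cycSigma (cycChart n t) i = 0 := h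
  linarith

/-- **`Ψ ∘ Φ = id` on the cell** (half-angle inversion). -/
theorem cycInv_cycChart {t : Fin (n + 2) → ℝ} (ht : t ∈ cycCell n) :
    cycInv (cycChart n t) = t := by
  funext i
  have hS : 0 ≤ tS (t i) := tS_nonneg (ht i).1.le
  have hC : 0 ≤ tC (t i) := (tC_pos_of_mem_cycCell ht i).le
  simp only [cycInv, cycSigma_cycChart ht, one_sub_tS_sq, Real.sqrt_sq hS, Real.sqrt_sq hC]
  exact tS_div_one_add_tC (t i)

/-- **The chart is injective on the cell.** -/
theorem injOn_cycChart : InjOn (cycChart n) (cycCell n) := fun a ha b hb h => by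
  rw [← cycInv_cycChart ha, ← cycInv_cycChart hb, h]

/-- **The chart maps the cell ONTO the open box.** -/
theorem image_cycChart : cycChart n '' cycCell n = kzOpenBox (n + 2) := by
  refine Subset.antisymm (image_subset_iff.mpr fun t ht => cycChart_mem ht) fun x hx => ?_
  exact ⟨cycInv x, cycInv_mem hx, cycChart_cycInv hx⟩

/-! ## The move -/

/-- The Jacobian factor `J(t) = (1 − (−1)ⁿ(∏ᵢ Φ(t)ᵢ)²) · ∏ᵢ W(tᵢ)`. -/
def cycJac (n : ℕ) (t : Fin (n + 2) → ℝ) : ℝ :=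
  (1 - (-1) ^ n * (∏ i, cycChart n t i) ^ 2) * ∏ i, tW (t i)

/-- Unfolding the Jacobian factor. -/
theorem cycJac_eq (t : Fin (n + 2) → ℝ) :
    cycJac n t = (1 - (-1) ^ n * (∏ i, cycChart n t i) ^ 2) * ∏ i, tW (t i) := rfl

/-- **One move of rule (2) along the cyclic tangent chart**: a representation pinned as
`[T, t ↦ g(Φ t)·J(t)]` is equivalent to one pinned as `[(0,1)ᵏ, g]`. -/
theorem equivalent_of_cycChart {r r' : IntegralRep (n + 2)} {f g : (Fin (n + 2) → ℝ) → ℝ}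
    (hfg : ∀ t ∈ cycCell n, f t = g (cycChart n t) * cycJac n t)
    (hrd : r.domain = cycCell n) (hri : EqOn r.integrand f (cycCell n))
    (hr'd : r'.domain = kzOpenBox (n + 2)) (hr'i : EqOn r'.integrand g (kzOpenBox (n + 2))) :
    Equivalent r r' :=
  equivalent_of_chart isSemialgebraicMapOn_cycChart (fun _ ht => hasFDerivAt_cycChart ht)
    injOn_cycChart image_cycChart (fun _ ht => abs_det_cycDeriv ht) hfg hrd hri hr'd hr'i

/-- Integrability transfer along the cyclic tangent chart. -/
theorem integrableOn_cycCell_iff {f g : (Fin (n + 2) → ℝ) → ℝ}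
    (hfg : ∀ t ∈ cycCell n, f t = g (cycChart n t) * cycJac n t) :
    IntegrableOn g (kzOpenBox (n + 2)) ↔ IntegrableOn f (cycCell n) := by
  rw [← image_cycChart]
  exact integrableOn_iff_of_chart (measurableSet_cycCell n) (fun _ ht => hasFDerivAt_cycChart ht)
    injOn_cycChart (fun _ ht => abs_det_cycDeriv ht) hfg

end SoloBlind

end Summit.KontsevichZagierPeriods.KontsevichZagierPeriods.Theorems
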